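import Mathlib.GroupTheory.GroupAction.ConjAct
import Mathlib.GroupTheory.QuotientGroup.Defs
import Mathlib.Topology.Algebra.Group.Basic
import Mathlib.Tactic.Group
import HarnessLib

/-!
# Continuous first cohomology `H¹(H, A)` as crossed homomorphisms (support file for [EtTh] §1)

[EtTh] §1 (Mochizuki, Publ. RIMS **45** (2009), PRIMS PDF p. 11) constructs "a certain cohomology
class in the [continuous] group cohomology of the tempered fundamental group" and manipulates classes
in `H¹(Π^tp_Ÿ, Δ_Θ)`, `H¹((Π^tp_Ÿ)^Θ, Δ_Θ)`, … by restriction, inflation and conjugation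
(Props. 1.3, 1.5, Thm. 1.6) [cite: MochizukiEtTh2009, §1 p.11]. Mathlib's continuous cohomology
(`Mathlib.RepresentationTheory.Homological.ContCohomology`, homogeneous cochains on `TopRep`) has at
present no degree-1 description by crossed homomorphisms, so this file provides the classical
concrete one (continuous crossed homomorphisms modulo principal ones,
[cite: NeukirchSchmidtWingberg2008, I §2 and II §7]) in exactly the shape [EtTh] §1 needs:

* the COEFFICIENTS are an abelian normal subgroup `A ≤ G'` of a topological group `G'` (in [EtTh]:
  `Δ_Θ ≤ (Π^tp_X)^Θ`), on which a topological group `G` acts by conjugation THROUGH a homomorphism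
  `φ : G →* G'` (in [EtTh]: `Π^tp_X ↠ (Π^tp_X)^Θ`, or the identity of `(Π^tp_X)^Θ`) — this avoids any
  `SMul`-instance bookkeeping: everything is multiplication in `G'`;
* `contCocycles φ A H`, `contCoboundaries φ A H`, `ContH1 φ A H` for a subgroup `H ≤ G` (a
  `CommGroup`, written multiplicatively; [EtTh] writes these groups additively, "log", p. 23);
* functoriality used in §1: `ContH1.res` (restriction to a smaller subgroup), `ContH1.infl`
  (the general compatible-pair PULL-BACK along a continuous `ψ : G₀ → G'` with `ψ(H₀) ≤ H'`, e.g.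
  `Π^tp_Ÿ → (Π^tp_Ÿ)^Θ`; NSW's "inflation" is the special case of a quotient map whose kernel acts
  trivially — no such hypothesis is imposed here), `ContH1.conj` (the conjugation action of `σ ∈ G` on
  `H¹(H, A)` for `H` normal — the action of `Z ≅ Π^tp_X/Π^tp_Y` in Prop. 1.5 (iii)).
* Generality note: `φ : G →* G'` is NOT assumed continuous in the definitions (only the cocycles are);
  this is slightly more general than NSW's topological `G`-modules and harmless — every [EtTh] use has
  `φ` continuous (`ThetaSetting.continuous_toTheta`).

Everything here is definitional (classical, [folklore]-level); no statement of [EtTh] is asserted.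
Seat abc-iut-L2-t1 (layer L2 of the abc-iut cell). TODO-merge(Mathlib): bridge to
`ContCohomology` in degree 1 when Mathlib acquires it; TODO-merge(abc-iut-L2-t3): the general
Kummer map of plan/LLANA-SPEC N13 targets `groupCohomology.H1` (discrete) — a comparison map is owed.
-/

namespace Literature.AnabelianGeometry.EtaleTheta

/-! ### Cocycles, coboundaries, `H¹` -/

section ContH1

variable {G G' : Type*} [Group G] [TopologicalSpace G]
  [Group G'] [TopologicalSpace G'] [IsTopologicalGroup G']
  (φ : G →* G') (A : Subgroup G') [A.Normal] [IsMulCommutative A]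

-- Mathlib's (deliberately scoped) instance `[Group G] [IsMulCommutative G] : CommGroup G`
-- (namespace `IsMulCommutative`, Mathlib/Algebra/Group/Defs.lean): the commutative coefficient subgroup
-- `A` is a `CommGroup` with the SAME operations, so cocycles with values in `A` form a commutative group.
open scoped IsMulCommutative

/-- Conjugation by a fixed element is continuous on a normal subgroup. [folklore] -/
private theorem continuous_conjNormal {G₁ : Type*} [Group G₁] [TopologicalSpace G₁]
    [IsTopologicalGroup G₁] {B : Subgroup G₁} [B.Normal] (g : G₁) :
    Continuous fun b : B => MulAut.conjNormal g b :=
  continuous_induced_rng.2 (by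
    simp only [Function.comp_def, MulAut.conjNormal_apply]
    fun_prop)

variable (H : Subgroup G)

/-- **Continuous 1-cocycles** of `H ≤ G` with values in the abelian normal subgroup `A ≤ G'`, where
`G` acts on `A` by conjugation through `φ : G → G'`: continuous `f : H → A` with
`f(gh) = f(g) · (φ(g) f(h) φ(g)⁻¹)`. [cite: NeukirchSchmidtWingberg2008, I §2 and II §7] -/
def contCocycles : Subgroup (H → A) where
  carrier := {f | Continuous f ∧ ∀ g h : H, f (g * h) = f g * MulAut.conjNormal (φ (g : G)) (f h)}
  one_mem' := ⟨continuous_const, fun g h => by simp⟩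
  mul_mem' {f₁ f₂} h₁ h₂ := ⟨h₁.1.mul h₂.1, fun g h => by
    simp only [Pi.mul_apply, h₁.2 g h, h₂.2 g h, map_mul]
    exact mul_mul_mul_comm _ _ _ _⟩
  inv_mem' {f} hf := ⟨hf.1.inv, fun g h => by
    simp only [Pi.inv_apply, hf.2 g h, map_inv, mul_inv]⟩

variable {φ A H} in
/-- Membership in `contCocycles`, unfolded. [cite: NeukirchSchmidtWingberg2008, I §2 and II §7] -/
theorem mem_contCocycles_iff (f : H → A) : f ∈ contCocycles φ A H ↔
    Continuous f ∧ ∀ g h : H, f (g * h) = f g * MulAut.conjNormal (φ (g : G)) (f h) :=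
  Iff.rfl

/-- **Continuous 1-coboundaries** (principal crossed homomorphisms) `h ↦ (φ(h) a φ(h)⁻¹) · a⁻¹`,
`a ∈ A`. [cite: NeukirchSchmidtWingberg2008, I §2 and II §7] -/
def contCoboundaries : Subgroup (H → A) where
  carrier := {f | ∃ a : A, f = fun h : H => MulAut.conjNormal (φ (h : G)) a * a⁻¹}
  one_mem' := ⟨1, by funext h; simp⟩
  mul_mem' := by
    rintro _ _ ⟨a, rfl⟩ ⟨b, rfl⟩
    refine ⟨a * b, ?_⟩
    funext h
    simp only [Pi.mul_apply, map_mul, mul_inv]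
    exact mul_mul_mul_comm _ _ _ _
  inv_mem' := by
    rintro _ ⟨a, rfl⟩
    refine ⟨a⁻¹, ?_⟩
    funext h
    simp only [Pi.inv_apply, map_inv, mul_inv, inv_inv]

variable {φ A H} in
omit [TopologicalSpace G] [TopologicalSpace G'] [IsTopologicalGroup G'] in
/-- Membership in `contCoboundaries`, unfolded. [cite: NeukirchSchmidtWingberg2008, I §2 and II §7] -/
theorem mem_contCoboundaries_iff (f : H → A) : f ∈ contCoboundaries φ A H ↔
    ∃ a : A, f = fun h : H => MulAut.conjNormal (φ (h : G)) a * a⁻¹ :=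
  Iff.rfl

/-- **Continuous first cohomology** `H¹(H, A)` (continuous crossed homomorphisms modulo principal
ones) of the subgroup `H ≤ G` with coefficients in the abelian normal subgroup `A ≤ G'`, `G` acting
by conjugation through `φ`. Mathlib's `ContCohomology` (homogeneous cochains on `TopRep`) has no
degree-1 crossed-homomorphism description at present; this concrete group is what [EtTh] §1
manipulates ("the [continuous] group cohomology of the tempered fundamental group", p. 11).
[cite: NeukirchSchmidtWingberg2008, I §2 and II §7] -/
def ContH1 : Type _ :=
  contCocycles φ A H ⧸ (contCoboundaries φ A H).subgroupOf (contCocycles φ A H)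

/-- `H¹(H, A)` is an abelian group (written multiplicatively here; [EtTh] writes it additively,
"log", p. 23). [cite: NeukirchSchmidtWingberg2008, I §2 and II §7] -/
instance : CommGroup (ContH1 φ A H) :=
  inferInstanceAs (CommGroup (contCocycles φ A H ⧸
    (contCoboundaries φ A H).subgroupOf (contCocycles φ A H)))

namespace ContH1

variable {φ A H}

/-- The class `[f] ∈ H¹(H, A)` of a continuous cocycle `f`. [cite: NeukirchSchmidtWingberg2008, I §2 and II §7] -/
def mk (f : H → A) (hf : f ∈ contCocycles φ A H) : ContH1 φ A H :=
  (QuotientGroup.mk (⟨f, hf⟩ : contCocycles φ A H) :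
    contCocycles φ A H ⧸ (contCoboundaries φ A H).subgroupOf (contCocycles φ A H))

variable (φ A)

/-- Restriction of cocycles along `H₁ ≤ H₂`. [cite: NeukirchSchmidtWingberg2008, I §2 and II §7] -/
def resCocycle {H₁ H₂ : Subgroup G} (h : H₁ ≤ H₂) :
    contCocycles φ A H₂ →* contCocycles φ A H₁ where
  toFun f := ⟨fun x => f.1 ⟨x.1, h x.2⟩, f.2.1.comp (continuous_subtype_val.subtype_mk _),
    fun g g' => f.2.2 ⟨g.1, h g.2⟩ ⟨g'.1, h g'.2⟩⟩
  map_one' := rfl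
  map_mul' _ _ := rfl

/-- **Restriction** `H¹(H₂, A) → H¹(H₁, A)` for `H₁ ≤ H₂` ("the restriction to …", pp. 20, 22).
[cite: NeukirchSchmidtWingberg2008, I §2 and II §7] -/
def res {H₁ H₂ : Subgroup G} (h : H₁ ≤ H₂) : ContH1 φ A H₂ →* ContH1 φ A H₁ :=
  QuotientGroup.map _ _ (resCocycle φ A h) (by
    intro f hf
    obtain ⟨a, ha⟩ := (mem_contCoboundaries_iff _).mp (Subgroup.mem_subgroupOf.mp hf)
    refine Subgroup.mem_subgroupOf.mpr ((mem_contCoboundaries_iff _).mpr ⟨a, ?_⟩)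
    funext x
    have := congrFun ha ⟨x.1, h x.2⟩
    simpa [resCocycle] using this)

variable {G₀ : Type*} [Group G₀] [TopologicalSpace G₀] (ψ : G₀ →* G') (hψ : Continuous ψ)


/-- Inflation/pull-back of cocycles along `ψ : G₀ → G'` from a subgroup `H' ≤ G'` containing
`ψ(H₀)`, for the conjugation action of `G'` on `A` (used for `(Π^tp_Ÿ)^Θ ← Π^tp_Ÿ`). [cite: NeukirchSchmidtWingberg2008, I §2 and II §7] -/
def inflCocycle {H₀ : Subgroup G₀} {H' : Subgroup G'} (h : H₀.map ψ ≤ H') :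
    contCocycles (MonoidHom.id G') A H' →* contCocycles ψ A H₀ where
  toFun f := ⟨fun x => f.1 ⟨ψ x.1, h ⟨x.1, x.2, rfl⟩⟩,
    f.2.1.comp ((hψ.comp continuous_subtype_val).subtype_mk _),
    fun g g' => by
      have := f.2.2 ⟨ψ g.1, h ⟨g.1, g.2, rfl⟩⟩ ⟨ψ g'.1, h ⟨g'.1, g'.2, rfl⟩⟩
      simpa only [MonoidHom.id_apply, Subgroup.coe_mul, map_mul, MulMemClass.mk_mul_mk] using this⟩
  map_one' := rfl
  map_mul' _ _ := rfl

/-- **Inflation** `H¹(H', A) → H¹(H₀, A)` along a continuous `ψ : G₀ → G'` with `ψ(H₀) ≤ H'`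
("any class … arises from a unique class …", Prop. 1.5 (iii), p. 23). [cite: NeukirchSchmidtWingberg2008, I §2 and II §7] -/
def infl {H₀ : Subgroup G₀} {H' : Subgroup G'} (h : H₀.map ψ ≤ H') :
    ContH1 (MonoidHom.id G') A H' →* ContH1 ψ A H₀ :=
  QuotientGroup.map _ _ (inflCocycle A ψ hψ h) (by
    intro f hf
    obtain ⟨a, ha⟩ := (mem_contCoboundaries_iff _).mp (Subgroup.mem_subgroupOf.mp hf)
    refine Subgroup.mem_subgroupOf.mpr ((mem_contCoboundaries_iff _).mpr ⟨a, ?_⟩)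
    funext x
    have := congrFun ha ⟨ψ x.1, h ⟨x.1, x.2, rfl⟩⟩
    simpa [inflCocycle] using this)

variable [IsTopologicalGroup G]

/-- Conjugation of cocycles by `σ ∈ G` on a normal subgroup `H`:
`(σ·f)(h) = φ(σ) f(σ⁻¹ h σ) φ(σ)⁻¹`. [cite: NeukirchSchmidtWingberg2008, I §2 and II §7] -/
def conjCocycle [H.Normal] (σ : G) :
    contCocycles φ A H →* contCocycles φ A H where
  toFun f := ⟨fun x => MulAut.conjNormal (φ σ) (f.1 (MulAut.conjNormal σ⁻¹ x)),
    (continuous_conjNormal (φ σ)).comp (f.2.1.comp (continuous_conjNormal σ⁻¹)),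
    fun x y => by
      dsimp only
      rw [map_mul, f.2.2, map_mul]
      congr 1
      rw [← MulAut.mul_apply, ← MulAut.mul_apply, ← map_mul, ← map_mul]
      congr 2
      rw [← map_mul, ← map_mul]
      congr 1
      simp only [MulAut.conjNormal_apply, inv_inv]
      group⟩
  map_one' := Subtype.ext (funext fun x => by simp)
  map_mul' f g := Subtype.ext (funext fun x => by simp)

/-- The **conjugation action** of `σ ∈ G` on `H¹(H, A)` for `H` normal in `G` (e.g. of
`a ∈ Z ≅ Π^tp_X/Π^tp_Y` on the classes of Prop. 1.5 (iii), p. 23). [cite: NeukirchSchmidtWingberg2008, I §2 and II §7] -/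
def conj [H.Normal] (σ : G) : ContH1 φ A H →* ContH1 φ A H :=
  QuotientGroup.map _ _ (conjCocycle φ A σ) (by
    intro f hf
    obtain ⟨a, ha⟩ := (mem_contCoboundaries_iff _).mp (Subgroup.mem_subgroupOf.mp hf)
    refine Subgroup.mem_subgroupOf.mpr ((mem_contCoboundaries_iff _).mpr
      ⟨MulAut.conjNormal (φ σ) a, ?_⟩)
    funext x
    have hx := congrFun ha (MulAut.conjNormal σ⁻¹ x)
    apply Subtype.ext
    change ((MulAut.conjNormal (φ σ) (f.1 (MulAut.conjNormal σ⁻¹ x)) : A) : G') = _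
    rw [hx]
    simp only [MulAut.conjNormal_apply, Subgroup.coe_mul, Subgroup.coe_inv]
    simp only [map_mul, map_inv, inv_inv]
    group)

end ContH1

end ContH1

end Literature.AnabelianGeometry.EtaleTheta
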